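/-
Copyright (c) 2026 the pub-hodgecm-mathlib formalisation cell (harness21).  Prover seat hodgecm-mathlib-F0P2-p08 (g3) (KW DESK OF RECORD, byte repair ruled 00:42:11Z (G2)):
Track B «K2-LIT», hLiu418 = stmt-HodgeConjecture-24832, residue #3 (x-a) KIND-W — the GUARDED edition of ★ `K2LiuKindWArchContinuationOfRecord` §1∕§3 and
★ `K2LiuKindWArchContinuationFramesOfRecord` §4: the per-place twisted Whittaker letter `hW` is asked ONLY at `det ↑S ≠ 0`.  THEOREMS ONLY.
-/
import Summits.HodgeConjecture.HodgeConjecture.Theorems.K2LiuKindWArchContinuationFramesOfRecord   -- ★ p863672 (LH4-p10): frames of record; brings ★ p863629 `hpresW`∕`hex_of_conjugator` and ★ p863520's imports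
import HarnessLib

/-!
# Crux `HLiu418`, residue #3 (x-a) KIND-W — (x-a-pres)(ii) OF RECORD, GUARDED: `hW` only at `det ↑S ≠ 0`

Cell `hodgecm-mathlib`, crux item hLiu418 = `stmt-HodgeConjecture-24832`; squad K2, KW desk F0P2-p08 (g3) ruling 00:42:11Z (G2) on K2E3-p11 (g10)'s (KW-arch-hW) census:
«★ p863629 ∕ ★ p863672 OVER-ASK `hW`: the binder wants `∃ Ew` for EVERY `S`, degenerate ones included, while §1's proof uses it only under the conclusion's guard
(`intro j S h _`); for `det ↑S = 0` no sign case of the dispatch applies and the letter can fail.  The `hW` byte of record is GUARDED.»  Lane `--supports stmt-HodgeConjecture-24832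
--as helper` (count-neutral).  THEOREMS ONLY (no `def`, no instance, no notation, no named-fact hypothesis, no `sorry`).

THE POINT.  Three siblings, byte-identical to their ★ originals except that the letter
`hW : ∀ S h w Q, ∃ Ew, …` becomes `hW : ∀ S, (S : Matrix (Fin 2) (Fin 2) L).det ≠ 0 → ∀ h w Q, ∃ Ew, …` (rest VERBATIM):
* §1 **`hpresW_of_flatTubeLetters'`** — ★ `K2LiuKindWArchContinuationOfRecord.hpresW_of_flatTubeLetters` with the guarded `hW` (proof: `intro j S h hS`, `hW S hS h w (Q r w)`);
* §2 **`hex_of_conjugator'`** — ★ `hex_of_conjugator` with the guarded `hW` (★ `hex_of_sumPresentation` ∘ §1 ∘ ★ FILE 18 `exists_flat_tube_presentation`, as ★ §2–§3);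
* §3 **`exists_frames_hex_of_std'`** — ★ `K2LiuKindWArchContinuationFramesOfRecord.exists_frames_hex_of_std` with the guarded `hW` in its `∀ eb, heb → hW → hex` tail
  (proof = ★ p863672's, calling §2).  This is the head the KIND-W tie `obtain`s its frames from; the (KW-arch-hW) dispatch `hW_of_signCases` (K2E3-p11) is stated ⊢ the
  guarded `hW` bytes :`(S : Matrix (Fin 2) (Fin 2) L).det ≠ 0 →` in hand as `hS`.
HONEST LABEL.  Count-neutral helper; `heb` and the guarded `hW` remain the named analytic inputs of the KIND-W `hex` column (definite: ★ p863390 ∕ W2-mirror; indefinite: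
«Φ6b-ind»): `HC_CM` is proved only modulo the 7 printed citations (2 remaining named inputs: hLiu418 = `stmt-HodgeConjecture-24832`, h413 = `stmt-HodgeConjecture-24833`)
until rung 0 closes.

## References
* [Shimura1997] G. Shimura, *Euler Products and Eisenstein Series*, CBMS 93 (1997), §16.4, §18.4.
* [KudlaRallis1994] S. Kudla, S. Rallis, Ann. of Math. 140 (1994), §1–§2.
* [Tan1999] V. Tan, *Poles of Siegel Eisenstein series on U(n,n)*, Canad. J. Math. 51 (1999), §1, §3.
* [MoeglinWaldspurger1995] C. Mœglin, J.-L. Waldspurger, *Spectral decomposition and Eisenstein series* (1995), IV.1.9.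
* [BorelJacquet1979] A. Borel, H. Jacquet, Proc. Symp. Pure Math. 33 (1979), §4.1.
-/

set_option autoImplicit false
set_option linter.dupNamespace false -- the mandated namespace repeats `HodgeConjecture.HodgeConjecture`

noncomputable section

open Complex Matrix MeasureTheory MeasureTheory.Measure NumberField NumberField.InfinitePlace IsDedekindDomain
open scoped ComplexConjugate NNReal Classical
open Literature.NumberTheory.GaloisRepresentations
open Literature.NumberTheory.Automorphic Literature.NumberTheory.Automorphic.UnitaryGroup
open Literature.NumberTheory.GelbartRogawski1991 Literature.NumberTheory.GelbartRogawski1991.GRConstruction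
open Literature.NumberTheory.GelbartRogawski1991.UnitaryDualPair
open Literature.NumberTheory.K2Lit.SiegelDoubled
open Literature.NumberTheory.ModularForms.SiegelUpperHalfSpace (moeb denom)

namespace Summit.HodgeConjecture.HodgeConjecture.Cruxes.HLiu418.K2LiuKindWArchContinuationGuardedOfRecord

open K2LiuU22CompactPictureDefs K2LiuArchInducedTubeDefs K2LiuSiegelUnipotentLocalDefs K2LiuArchSWSpanningDefs
open K2LiuSiegelUnipotentFourierDefs (skewMatrices unipDeltaChar)
open K2LiuSiegelEisensteinKindWLetters (kindWFinset)
open K2LiuHermitianTubeFrameSign (exists_tubeFrame_arch₄)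
open K2LiuHermitianTubeFrameArch (tw_ne_zero)
open K2LiuArchSiegelCharacterTube (isUnit_det_shimuraFrame)
open K2LiuArchReadingFrame (exists_readingFrame)
open K2LiuArchSiegelCharacterTubeConsumer (tube_eq_of_chart_formula)
open K2LiuArchFrameBridge (kappa_eq)
open K2LiuArchFrameCompactConjugator (exists_frameCompact_conjugator)
open K2LiuKindWArchLetterDefs (archWhittakerIntegral)
open K2LiuKindWArchContinuationBridge (hex_of_sumPresentation)
open K2LiuArchFlatTubePresentation (exists_flat_tube_presentation)
open K2LiuKindWArchContinuationOfRecord (differentiableOn_height_cpow)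

variable (L : Type) [Field L] [NumberField L] [IsCMField L]
variable {N₀ M₀ : ℕ} (e : Fin N₀ × Fin M₀ ≃ Fin 2)
  (dV : Fin N₀ → L) (hdV : ∀ i, IsCMField.complexConj L (dV i) = dV i)
  (dW : Fin M₀ → L) (hdW : ∀ i, IsCMField.complexConj L (dW i) = dW i)

section Letters

variable (Fr : UnitaryGroup.arch (Fp L) L (IsCMField.complexConj L) (2 + 2) (hermD L e dV hdV dW hdW) →
    {w : InfinitePlace L // w.IsComplex} → Matrix (Fin 2 ⊕ Fin 2) (Fin 2 ⊕ Fin 2) ℂ)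

/-! ## §1 `hpresW` from ★ FILE 18's clauses and the (KW-fac) reading — `hW` GUARDED -/

/-- **★ `hpresW_of_flatTubeLetters`, GUARDED.**  Same inputs and conclusion as ★ `K2LiuKindWArchContinuationOfRecord.hpresW_of_flatTubeLetters`, except that the per-place
twisted Whittaker letter is asked only at non-degenerate indices: `hW : ∀ S, det ↑S ≠ 0 → ∀ h w Q, ∃ Ew, …` (rest VERBATIM).  The conclusion is itself guarded by
`det ↑S ≠ 0`, so the proof is ★'s with the guard threaded (`hW S hS h w (Q r w)`).
[cite: Shimura1997, §16.4, §18.4] [cite: KudlaRallis1994, §1–§2] [cite: MoeglinWaldspurger1995, IV.1.9] [cite: BorelJacquet1979, §4.1] -/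
theorem hpresW_of_flatTubeLetters' (B C : {w : InfinitePlace L // w.IsComplex} → Matrix (Fin 2) (Fin 2) ℂ)
    (t : InfinitePlace L → ℤ) (𝒦 : IwasawaDatum L e dV hdV dW hdW)
    (g : UnitaryGroup.arch (Fp L) L (IsCMField.complexConj L) (2 + 2) (hermD L e dV hdV dW hdW)) (s₀ : ℂ)
    {m : ℕ} (A : Fin m → UnitaryGroup.arch (Fp L) L (IsCMField.complexConj L) (2 + 2) (hermD L e dV hdV dW hdW) → ℂ)
    (hflat : ∀ j : Fin m, ∃ (mr : ℕ) (c : Fin mr → ℂ) (Q : Fin mr → {w : InfinitePlace L // w.IsComplex} → Carrier)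
      (F : Fin mr → {w : InfinitePlace L // w.IsComplex} → Matrix (Fin 2 ⊕ Fin 2) (Fin 2 ⊕ Fin 2) ℂ → ℂ),
      (∀ s r w, IsArchSiegelSection (fun z : ℂ => (conj z / ((‖z‖ : ℝ) : ℂ)) ^ (-(t w.1))) s
        (fun x => (((‖(denom x (I • (1 : Matrix (Fin 2) (Fin 2) ℂ))).det‖ : ℝ) : ℂ) ^ (2 * (s₀ - s))) * F r w x)) ∧
      (∀ s r w (v : Matrix (Fin 2) (Fin 2) ℂ), vᴴ * v = 1 → ∀ hv : v.det ≠ 0,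
        (fun x => (((‖(denom x (I • (1 : Matrix (Fin 2) (Fin 2) ℂ))).det‖ : ℝ) : ℂ) ^ (2 * (s₀ - s))) * F r w x)
          ((2 : ℂ)⁻¹ • fromBlocks (1 + v) (-(I • (1 - v))) (I • (1 - v)) (1 + v) : Matrix (Fin 2 ⊕ Fin 2) (Fin 2 ⊕ Fin 2) ℂ) = evalAt v hv (Q r w)) ∧
      ∀ (s : ℂ) (a : UnitaryGroup.arch (Fp L) L (IsCMField.complexConj L) (2 + 2) (hermD L e dV hdV dW hdW)),
        (((modDelta L e dV hdV dW hdW (𝒦.pPart (UnitaryGroup.archToAdelic (Fp L) L (IsCMField.complexConj L) (2 + 2) (hermD L e dV hdV dW hdW) a)) : ℝ) : ℂ) ^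
            (2 * (s - s₀))) * A j a =
          (((modDelta L e dV hdV dW hdW (𝒦.pPart (UnitaryGroup.archToAdelic (Fp L) L (IsCMField.complexConj L) (2 + 2) (hermD L e dV hdV dW hdW) g⁻¹)) : ℝ) : ℂ) ^
            (2 * (s - s₀))) *
          ∑ r, c r * ∏ w, (((‖(denom (Fr (a * g) w) (I • (1 : Matrix (Fin 2) (Fin 2) ℂ))).det‖ : ℝ) : ℂ) ^ (2 * (s₀ - s))) * F r w (Fr (a * g) w))
    (FinfT : Fin m → skewMatrices ((IsCMField.complexConj L : L ≃ₐ[Fp L] L) : L →+* L) ((gramR L e dV hdV dW hdW).map (algebraMap (Fp L) L)) →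
      HA L e dV hdV dW hdW → ℂ → UnitaryGroup.arch (Fp L) L (IsCMField.complexConj L) (2 + 2) (hermD L e dV hdV dW hdW) → ℂ)
    (hread : ∀ (S : skewMatrices ((IsCMField.complexConj L : L ≃ₐ[Fp L] L) : L →+* L) ((gramR L e dV hdV dW hdW).map (algebraMap (Fp L) L)))
      (h : HA L e dV hdV dW hdW) (s : ℂ) (j : Fin m) (a : UnitaryGroup.arch (Fp L) L (IsCMField.complexConj L) (2 + 2) (hermD L e dV hdV dW hdW)),
      FinfT j S h s a =
        (((modDelta L e dV hdV dW hdW (𝒦.pPart (UnitaryGroup.archToAdelic (Fp L) L (IsCMField.complexConj L) (2 + 2) (hermD L e dV hdV dW hdW) a)) : ℝ) : ℂ) ^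
            (2 * (s - s₀))) * A j a)
    (eb : skewMatrices ((IsCMField.complexConj L : L ≃ₐ[Fp L] L) : L →+* L) ((gramR L e dV hdV dW hdW).map (algebraMap (Fp L) L)) → HA L e dV hdV dW hdW →
      {w : InfinitePlace L // w.IsComplex} → Matrix (Fin 2) (Fin 2) ℂ → ℂ)
    (heb : ∀ (S : skewMatrices ((IsCMField.complexConj L : L ≃ₐ[Fp L] L) : L →+* L) ((gramR L e dV hdV dW hdW).map (algebraMap (Fp L) L)))
      (h : HA L e dV hdV dW hdW) (u : ↥(unipDeltaArch L e dV hdV dW hdW)),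
      (conj (unipDeltaChar L e dV hdV dW hdW (S : Matrix (Fin 2) (Fin 2) L)
          (UnitaryGroup.archToAdelic (Fp L) L (IsCMField.complexConj L) (2 + 2) (hermD L e dV hdV dW hdW)
            (u : UnitaryGroup.arch (Fp L) L (IsCMField.complexConj L) (2 + 2) (hermD L e dV hdV dW hdW))) : ℂ)) =
        ∏ w, eb S h w (Matrix.toBlocks₁₂ (Fr (u : UnitaryGroup.arch (Fp L) L (IsCMField.complexConj L) (2 + 2) (hermD L e dV hdV dW hdW)) w)))
    (hW : ∀ (S : skewMatrices ((IsCMField.complexConj L : L ≃ₐ[Fp L] L) : L →+* L) ((gramR L e dV hdV dW hdW).map (algebraMap (Fp L) L))),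
      (S : Matrix (Fin 2) (Fin 2) L).det ≠ 0 → ∀ (h : HA L e dV hdV dW hdW) (w : {w : InfinitePlace L // w.IsComplex}) (Q : Carrier),
      ∃ Ew : ℂ → ℂ, DifferentiableOn ℂ Ew {s : ℂ | 0 < s.re} ∧ ∀ s : ℂ, ((2 : ℕ) : ℝ) / 2 < s.re →
        ∀ F : Matrix (Fin 2 ⊕ Fin 2) (Fin 2 ⊕ Fin 2) ℂ → ℂ, IsArchSiegelSection (fun z : ℂ => (conj z / ((‖z‖ : ℝ) : ℂ)) ^ (-(t w.1))) s F →
          (∀ (v : Matrix (Fin 2) (Fin 2) ℂ), vᴴ * v = 1 → ∀ hv : v.det ≠ 0,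
            F ((2 : ℂ)⁻¹ • fromBlocks (1 + v) (-(I • (1 - v))) (I • (1 - v)) (1 + v) : Matrix (Fin 2 ⊕ Fin 2) (Fin 2 ⊕ Fin 2) ℂ) = evalAt v hv Q) →
          ∫ x : Fin 2 → Fin 2 → ℝ, F ((fromBlocks 0 (B w) (C w) 0 : Matrix (Fin 2 ⊕ Fin 2) (Fin 2 ⊕ Fin 2) ℂ) * fromBlocks 1 (hermOfReal x) 0 1 *
              Fr (UnitaryGroup.archPart (Fp L) L (IsCMField.complexConj L) (2 + 2) (hermD L e dV hdV dW hdW) h * g) w) *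
            eb S h w (hermOfReal x) = Ew s) :
    ∀ (j : Fin m) (S : skewMatrices ((IsCMField.complexConj L : L ≃ₐ[Fp L] L) : L →+* L) ((gramR L e dV hdV dW hdW).map (algebraMap (Fp L) L)))
      (h : HA L e dV hdV dW hdW), (S : Matrix (Fin 2) (Fin 2) L).det ≠ 0 →
      ∃ (k : {w : InfinitePlace L // w.IsComplex} → ℤ) (eb : {w : InfinitePlace L // w.IsComplex} → Matrix (Fin 2) (Fin 2) ℂ → ℂ)
        (g : UnitaryGroup.arch (Fp L) L (IsCMField.complexConj L) (2 + 2) (hermD L e dV hdV dW hdW))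
        (mr : ℕ) (c : Fin mr → ℂ) (Q : Fin mr → {w : InfinitePlace L // w.IsComplex} → Carrier) (Cst : ℂ → ℂ)
        (Gs : ℂ → Fin mr → {w : InfinitePlace L // w.IsComplex} → Matrix (Fin 2 ⊕ Fin 2) (Fin 2 ⊕ Fin 2) ℂ → ℂ),
        (∀ u : ↥(unipDeltaArch L e dV hdV dW hdW),
          (conj (unipDeltaChar L e dV hdV dW hdW (S : Matrix (Fin 2) (Fin 2) L)
              (UnitaryGroup.archToAdelic (Fp L) L (IsCMField.complexConj L) (2 + 2) (hermD L e dV hdV dW hdW)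
                (u : UnitaryGroup.arch (Fp L) L (IsCMField.complexConj L) (2 + 2) (hermD L e dV hdV dW hdW))) : ℂ)) =
            ∏ w, eb w (Matrix.toBlocks₁₂ (Fr (u : UnitaryGroup.arch (Fp L) L (IsCMField.complexConj L) (2 + 2) (hermD L e dV hdV dW hdW)) w))) ∧
        (∀ r w, ∃ Ew : ℂ → ℂ, DifferentiableOn ℂ Ew {s : ℂ | 0 < s.re} ∧ ∀ s : ℂ, ((2 : ℕ) : ℝ) / 2 < s.re →
          ∀ F : Matrix (Fin 2 ⊕ Fin 2) (Fin 2 ⊕ Fin 2) ℂ → ℂ, IsArchSiegelSection (fun z : ℂ => (conj z / ((‖z‖ : ℝ) : ℂ)) ^ (k w)) s F →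
            (∀ (v : Matrix (Fin 2) (Fin 2) ℂ), vᴴ * v = 1 → ∀ hv : v.det ≠ 0,
              F ((2 : ℂ)⁻¹ • fromBlocks (1 + v) (-(I • (1 - v))) (I • (1 - v)) (1 + v) : Matrix (Fin 2 ⊕ Fin 2) (Fin 2 ⊕ Fin 2) ℂ) = evalAt v hv (Q r w)) →
            ∫ x : Fin 2 → Fin 2 → ℝ, F ((fromBlocks 0 (B w) (C w) 0 : Matrix (Fin 2 ⊕ Fin 2) (Fin 2 ⊕ Fin 2) ℂ) * fromBlocks 1 (hermOfReal x) 0 1 *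
                Fr (UnitaryGroup.archPart (Fp L) L (IsCMField.complexConj L) (2 + 2) (hermD L e dV hdV dW hdW) h * g) w) *
              eb w (hermOfReal x) = Ew s) ∧
        DifferentiableOn ℂ Cst {s : ℂ | 0 < s.re} ∧
        (∀ s : ℂ, ((2 : ℕ) : ℝ) / 2 < s.re → ∀ r w, IsArchSiegelSection (fun z : ℂ => (conj z / ((‖z‖ : ℝ) : ℂ)) ^ (k w)) s (Gs s r w)) ∧
        (∀ s : ℂ, ((2 : ℕ) : ℝ) / 2 < s.re → ∀ r w, ∀ (v : Matrix (Fin 2) (Fin 2) ℂ), vᴴ * v = 1 → ∀ hv : v.det ≠ 0,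
          (Gs s r w) ((2 : ℂ)⁻¹ • fromBlocks (1 + v) (-(I • (1 - v))) (I • (1 - v)) (1 + v) : Matrix (Fin 2 ⊕ Fin 2) (Fin 2 ⊕ Fin 2) ℂ) = evalAt v hv (Q r w)) ∧
        (∀ s : ℂ, ((2 : ℕ) : ℝ) / 2 < s.re → ∀ a : UnitaryGroup.arch (Fp L) L (IsCMField.complexConj L) (2 + 2) (hermD L e dV hdV dW hdW),
          FinfT j S h s a = Cst s * ∑ r, c r * ∏ w, Gs s r w (Fr (a * g) w)) := by
  intro j S h hS
  obtain ⟨mr, c, Q, F, hF, hQ, hsum⟩ := hflat j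
  exact ⟨fun w => -(t w.1), eb S h, g, mr, c, Q,
    (fun s => (((modDelta L e dV hdV dW hdW (𝒦.pPart (UnitaryGroup.archToAdelic (Fp L) L (IsCMField.complexConj L) (2 + 2) (hermD L e dV hdV dW hdW) g⁻¹)) : ℝ) : ℂ) ^
      (2 * (s - s₀)))),
    (fun s r w x => (((‖(denom x (I • (1 : Matrix (Fin 2) (Fin 2) ℂ))).det‖ : ℝ) : ℂ) ^ (2 * (s₀ - s))) * F r w x),
    heb S h, (fun r w => hW S hS h w (Q r w)), differentiableOn_height_cpow (modDelta_pos L e dV hdV dW hdW _) s₀,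
    (fun s _ r w => hF s r w), (fun s _ r w => hQ s r w), fun s _ a => by rw [hread S h s j a, hsum s a]⟩

/-! ## §2 The `hex` bytes modulo the conjugator — `hW` GUARDED -/

section Hex

variable (T Tinv : {w : InfinitePlace L // w.IsComplex} → Matrix (Fin 2 ⊕ Fin 2) (Fin 2 ⊕ Fin 2) ℂ)
  (hFr : ∀ a w, Fr a w = T w * Matrix.reindex (e₂ (n := 2)).symm (e₂ (n := 2)).symm
    (((UnitaryGroup.archAt (Fp L) L (IsCMField.complexConj L) (2 + 2) (hermD L e dV hdV dW hdW) w
      (UnitaryGroup.complexConj_smul_infinitePlace L w.1) (IsCMField.complexConj_ne_one L) a :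
        UnitaryGroup.archLocal L (2 + 2) (hermD L e dV hdV dW hdW) w) : GL (Fin (2 + 2)) ℂ) : Matrix (Fin (2 + 2)) (Fin (2 + 2)) ℂ) * Tinv w)
  (hT2 : ∀ w, Tinv w * T w = 1)
  (hTU : ∀ w (g : GL (Fin (2 + 2)) ℂ), g ∈ UnitaryGroup.archLocal L (2 + 2) (hermD L e dV hdV dW hdW) w →
    (T w * Matrix.reindex (e₂ (n := 2)).symm (e₂ (n := 2)).symm (g : Matrix _ _ ℂ) * Tinv w)ᴴ * Matrix.J (Fin 2) ℂ *
      (T w * Matrix.reindex (e₂ (n := 2)).symm (e₂ (n := 2)).symm (g : Matrix _ _ ℂ) * Tinv w) = Matrix.J (Fin 2) ℂ)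
  [MeasurableSpace ↥(unipDeltaArch L e dV hdV dW hdW)] [BorelSpace ↥(unipDeltaArch L e dV hdV dW hdW)]

include hFr hT2 hTU in
/-- **★ `hex_of_conjugator`, GUARDED.**  ★ p863152's `hex` VERBATIM from ★ FILE 18's frame letters BY VALUE, the unipotent letters, `hBC`, an Iwasawa datum `𝒦`, a conjugator
`g` with its letter `hg`, `ht`, `s₀`, the (KW-fac) arch clauses `hAlaw hfin hAc`, the bad set, the Haar carriers, `FinfT` with `hread`, the frame reading `heb` — and the
GUARDED twisted Whittaker letters `hW : ∀ S, det ↑S ≠ 0 → ∀ h w Q, ∃ Ew, …`.  Proof: ★ `hex_of_sumPresentation` ∘ §1 ∘ ★ FILE 18 `exists_flat_tube_presentation` (★ §2–§3's terms).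
[cite: Shimura1997, §16.4, §18.4] [cite: KudlaRallis1994, §1–§2] [cite: Tan1999, §1, §3] [cite: BorelJacquet1979, §4.1] -/
theorem hex_of_conjugator' (hdV0 : ∀ i, dV i ≠ 0) (hdW0 : ∀ i, dW i ≠ 0) (hT1 : ∀ w, T w * Tinv w = 1)
    (hTiv : ∀ w (u : GL (Fin (2 + 2)) ℂ), u ∈ UnitaryGroup.archLocal L (2 + 2) (hermD L e dV hdV dW hdW) w →
      K2LiuSiegelUnipotentLocalDefs.IsUnipM (n := 2) (u : Matrix (Fin (2 + 2)) (Fin (2 + 2)) ℂ) →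
        ∃ b : Matrix (Fin 2) (Fin 2) ℂ, bᴴ = b ∧ T w * Matrix.reindex (e₂ (n := 2)).symm (e₂ (n := 2)).symm (u : Matrix _ _ ℂ) * Tinv w = fromBlocks 1 b 0 1)
    (hTN : ∀ w (b : Matrix (Fin 2) (Fin 2) ℂ), bᴴ = b → ∃ u : GL (Fin (2 + 2)) ℂ,
      u ∈ UnitaryGroup.archLocal L (2 + 2) (hermD L e dV hdV dW hdW) w ∧ K2LiuSiegelUnipotentLocalDefs.IsUnipM (n := 2) (u : Matrix (Fin (2 + 2)) (Fin (2 + 2)) ℂ) ∧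
        T w * Matrix.reindex (e₂ (n := 2)).symm (e₂ (n := 2)).symm (u : Matrix _ _ ℂ) * Tinv w = fromBlocks 1 b 0 1)
    (hTS : ∀ w (g : GL (Fin (2 + 2)) ℂ), IsSiegelM (n := 2) (g : Matrix (Fin (2 + 2)) (Fin (2 + 2)) ℂ) →
      (T w * Matrix.reindex (e₂ (n := 2)).symm (e₂ (n := 2)).symm (g : Matrix _ _ ℂ) * Tinv w).toBlocks₂₁ = 0)
    (hTV : ∀ w (P : Matrix (Fin 2 ⊕ Fin 2) (Fin 2 ⊕ Fin 2) ℂ), Pᴴ * Matrix.J (Fin 2) ℂ * P = Matrix.J (Fin 2) ℂ →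
      ∃ g : GL (Fin (2 + 2)) ℂ, g ∈ UnitaryGroup.archLocal L (2 + 2) (hermD L e dV hdV dW hdW) w ∧
        T w * Matrix.reindex (e₂ (n := 2)).symm (e₂ (n := 2)).symm (g : Matrix _ _ ℂ) * Tinv w = P)
    (Dsh Csh : {w : InfinitePlace L // w.IsComplex} → Matrix (Fin 2) (Fin 2) ℂ)
    (hTsh : ∀ w, T w = fromBlocks (Dsh w) (Dsh w) (Csh w) (-(Csh w))) (hD : ∀ w, IsUnit (Dsh w).det) (hC : ∀ w, IsUnit (Csh w).det)
    (fr : ∀ w : {w : InfinitePlace L // w.IsComplex}, Matrix.unitaryGroup (Fin 2) ℂ →* UnitaryGroup.archLocal L (2 + 2) (hermD L e dV hdV dW hdW) w)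
    (hfrc : ∀ w, Continuous (fr w))
    (hfrτ : ∀ w (u : Matrix.unitaryGroup (Fin 2) ℂ),
      T w * Matrix.reindex (e₂ (n := 2)).symm (e₂ (n := 2)).symm (((fr w u : UnitaryGroup.archLocal L (2 + 2) (hermD L e dV hdV dW hdW) w) : GL (Fin (2 + 2)) ℂ) :
        Matrix (Fin (2 + 2)) (Fin (2 + 2)) ℂ) * Tinv w =
      (2 : ℂ)⁻¹ • fromBlocks (1 + (u : Matrix (Fin 2) (Fin 2) ℂ)) (-(I • (1 - (u : Matrix (Fin 2) (Fin 2) ℂ)))) (I • (1 - (u : Matrix (Fin 2) (Fin 2) ℂ))) (1 + (u : Matrix (Fin 2) (Fin 2) ℂ)))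
    (B C : {w : InfinitePlace L // w.IsComplex} → Matrix (Fin 2) (Fin 2) ℂ) (hBC : ∀ w, T w * fromBlocks 1 0 0 (-1) * Tinv w = fromBlocks 0 (B w) (C w) 0)
    (T₀ : Finset (HeightOneSpectrum (𝓞 (Fp L))))
    (νinf : Finset (HeightOneSpectrum (𝓞 (Fp L))) → Measure ↥(unipDeltaArch L e dV hdV dW hdW)) [∀ T' : Finset (HeightOneSpectrum (𝓞 (Fp L))), (νinf T').IsHaarMeasure]
    (𝒦 : IwasawaDatum L e dV hdV dW hdW)
    (g : UnitaryGroup.arch (Fp L) L (IsCMField.complexConj L) (2 + 2) (hermD L e dV hdV dW hdW))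
    (hg : ∀ k : UnitaryGroup.arch (Fp L) L (IsCMField.complexConj L) (2 + 2) (hermD L e dV hdV dW hdW),
      (∀ w, moeb (Fr k w) (I • (1 : Matrix (Fin 2) (Fin 2) ℂ)) = I • 1) →
        (UnitaryGroup.archToAdelic (Fp L) L (IsCMField.complexConj L) (2 + 2) (hermD L e dV hdV dW hdW) (g * k * g⁻¹) : HA L e dV hdV dW hdW) ∈ 𝒦.K)
    {χ : HeckeCharacter L} {t : InfinitePlace L → ℤ} (ht : χ.HasUnitaryArchType t 0) (s₀ : ℂ)
    {m : ℕ} (A : Fin m → UnitaryGroup.arch (Fp L) L (IsCMField.complexConj L) (2 + 2) (hermD L e dV hdV dW hdW) → ℂ)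
    (hAlaw : ∀ j, ∀ p : HA L e dV hdV dW hdW, IsSiegelDelta L e dV hdV dW hdW p → UnitaryGroup.finPart (Fp L) L (IsCMField.complexConj L) (2 + 2) (hermD L e dV hdV dW hdW) p = 1 →
      ∀ x : UnitaryGroup.arch (Fp L) L (IsCMField.complexConj L) (2 + 2) (hermD L e dV hdV dW hdW),
        A j (UnitaryGroup.archPart (Fp L) L (IsCMField.complexConj L) (2 + 2) (hermD L e dV hdV dW hdW) p * x) = siegelDeltaCharacter L e dV hdV dW hdW χ s₀ p * A j x)
    (hfin : ∀ j, ∃ V : Submodule ℂ (UnitaryGroup.arch (Fp L) L (IsCMField.complexConj L) (2 + 2) (hermD L e dV hdV dW hdW) → ℂ), FiniteDimensional ℂ V ∧ A j ∈ V ∧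
      ∀ a₀ : UnitaryGroup.arch (Fp L) L (IsCMField.complexConj L) (2 + 2) (hermD L e dV hdV dW hdW),
        (UnitaryGroup.archToAdelic (Fp L) L (IsCMField.complexConj L) (2 + 2) (hermD L e dV hdV dW hdW) a₀ : HA L e dV hdV dW hdW) ∈ 𝒦.K → ∀ G ∈ V, (fun x => G (x * a₀)) ∈ V)
    (hAc : ∀ j, Continuous (A j))
    (FinfT : Fin m → skewMatrices ((IsCMField.complexConj L : L ≃ₐ[Fp L] L) : L →+* L) ((gramR L e dV hdV dW hdW).map (algebraMap (Fp L) L)) →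
      HA L e dV hdV dW hdW → ℂ → UnitaryGroup.arch (Fp L) L (IsCMField.complexConj L) (2 + 2) (hermD L e dV hdV dW hdW) → ℂ)
    (hread : ∀ (S : skewMatrices ((IsCMField.complexConj L : L ≃ₐ[Fp L] L) : L →+* L) ((gramR L e dV hdV dW hdW).map (algebraMap (Fp L) L)))
      (h : HA L e dV hdV dW hdW) (s : ℂ) (j : Fin m) (a : UnitaryGroup.arch (Fp L) L (IsCMField.complexConj L) (2 + 2) (hermD L e dV hdV dW hdW)),
      FinfT j S h s a =
        (((modDelta L e dV hdV dW hdW (𝒦.pPart (UnitaryGroup.archToAdelic (Fp L) L (IsCMField.complexConj L) (2 + 2) (hermD L e dV hdV dW hdW) a)) : ℝ) : ℂ) ^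
            (2 * (s - s₀))) * A j a)
    (eb : skewMatrices ((IsCMField.complexConj L : L ≃ₐ[Fp L] L) : L →+* L) ((gramR L e dV hdV dW hdW).map (algebraMap (Fp L) L)) → HA L e dV hdV dW hdW →
      {w : InfinitePlace L // w.IsComplex} → Matrix (Fin 2) (Fin 2) ℂ → ℂ)
    (heb : ∀ (S : skewMatrices ((IsCMField.complexConj L : L ≃ₐ[Fp L] L) : L →+* L) ((gramR L e dV hdV dW hdW).map (algebraMap (Fp L) L)))
      (h : HA L e dV hdV dW hdW) (u : ↥(unipDeltaArch L e dV hdV dW hdW)),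
      (conj (unipDeltaChar L e dV hdV dW hdW (S : Matrix (Fin 2) (Fin 2) L)
          (UnitaryGroup.archToAdelic (Fp L) L (IsCMField.complexConj L) (2 + 2) (hermD L e dV hdV dW hdW)
            (u : UnitaryGroup.arch (Fp L) L (IsCMField.complexConj L) (2 + 2) (hermD L e dV hdV dW hdW))) : ℂ)) =
        ∏ w, eb S h w (Matrix.toBlocks₁₂ (Fr (u : UnitaryGroup.arch (Fp L) L (IsCMField.complexConj L) (2 + 2) (hermD L e dV hdV dW hdW)) w)))
    (hW : ∀ (S : skewMatrices ((IsCMField.complexConj L : L ≃ₐ[Fp L] L) : L →+* L) ((gramR L e dV hdV dW hdW).map (algebraMap (Fp L) L))),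
      (S : Matrix (Fin 2) (Fin 2) L).det ≠ 0 → ∀ (h : HA L e dV hdV dW hdW) (w : {w : InfinitePlace L // w.IsComplex}) (Q : Carrier),
      ∃ Ew : ℂ → ℂ, DifferentiableOn ℂ Ew {s : ℂ | 0 < s.re} ∧ ∀ s : ℂ, ((2 : ℕ) : ℝ) / 2 < s.re →
        ∀ F : Matrix (Fin 2 ⊕ Fin 2) (Fin 2 ⊕ Fin 2) ℂ → ℂ, IsArchSiegelSection (fun z : ℂ => (conj z / ((‖z‖ : ℝ) : ℂ)) ^ (-(t w.1))) s F →
          (∀ (v : Matrix (Fin 2) (Fin 2) ℂ), vᴴ * v = 1 → ∀ hv : v.det ≠ 0,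
            F ((2 : ℂ)⁻¹ • fromBlocks (1 + v) (-(I • (1 - v))) (I • (1 - v)) (1 + v) : Matrix (Fin 2 ⊕ Fin 2) (Fin 2 ⊕ Fin 2) ℂ) = evalAt v hv Q) →
          ∫ x : Fin 2 → Fin 2 → ℝ, F ((fromBlocks 0 (B w) (C w) 0 : Matrix (Fin 2 ⊕ Fin 2) (Fin 2 ⊕ Fin 2) ℂ) * fromBlocks 1 (hermOfReal x) 0 1 *
              Fr (UnitaryGroup.archPart (Fp L) L (IsCMField.complexConj L) (2 + 2) (hermD L e dV hdV dW hdW) h * g) w) *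
            eb S h w (hermOfReal x) = Ew s) :
    ∀ (j : Fin m) (S : skewMatrices ((IsCMField.complexConj L : L ≃ₐ[Fp L] L) : L →+* L) ((gramR L e dV hdV dW hdW).map (algebraMap (Fp L) L)))
      (h : HA L e dV hdV dW hdW), (S : Matrix (Fin 2) (Fin 2) L).det ≠ 0 →
      ∃ F : ℂ → ℂ, DifferentiableOn ℂ F {s : ℂ | 0 < s.re} ∧ ∀ s : ℂ, ((2 : ℕ) : ℝ) / 2 < s.re → F s =
        archWhittakerIntegral L e dV hdV dW hdW (νinf (kindWFinset L e dV hdV dW hdW T₀ (S : Matrix (Fin 2) (Fin 2) L) h)) (S : Matrix (Fin 2) (Fin 2) L)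
          (FinfT j S h) (UnitaryGroup.archPart (Fp L) L (IsCMField.complexConj L) (2 + 2) (hermD L e dV hdV dW hdW) h) s :=
  hex_of_sumPresentation L e dV hdV dW hdW T Tinv Fr hFr hT2 hTU hT1 hTiv hTN B C hBC T₀ νinf FinfT
    (hpresW_of_flatTubeLetters' L e dV hdV dW hdW Fr B C t 𝒦 g s₀ A
      (fun j => exists_flat_tube_presentation L e dV hdV hdV0 dW hdW hdW0 T Tinv Fr hFr hT1 hT2 hTU hTS hTV Dsh Csh hTsh hD hC fr hfrc hfrτ 𝒦 g hg ht s₀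
        (isArchSiegelDeltaSection_of_finPart_eq_one L e dV hdV dW hdW (hAlaw j)) (hfin j) (hAc j))
      FinfT hread eb heb hW)

end Hex

end Letters

/-! ## §3 The frames of record and the `hex` letter modulo `heb` and the GUARDED `hW` -/

variable [MeasurableSpace ↥(unipDeltaArch L e dV hdV dW hdW)] [BorelSpace ↥(unipDeltaArch L e dV hdV dW hdW)]

/-- **★ `exists_frames_hex_of_std`, GUARDED — THE HEAD THE KIND-W TIE `obtain`S ITS FRAMES FROM.**  ★ `K2LiuKindWArchContinuationFramesOfRecord.exists_frames_hex_of_std`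
VERBATIM (closed-form ★ arch₄ frames `T T⁻¹`, `Fr`, `B C`, the ★ FILE 21 conjugator `g`, every frame fact), except that in the tail `∀ eb, heb → hW → hex` the letter `hW` is
GUARDED: `∀ S, (S : Matrix (Fin 2) (Fin 2) L).det ≠ 0 → ∀ h w Q, ∃ Ew, …`.  Proof = ★ p863672's (★ p863520 §3's preamble), calling §2.
[cite: Shimura1997, §16.4, §18.4] [cite: KudlaRallis1994, §1–§2] [cite: Tan1999, §1, §3] [cite: BorelJacquet1979, §4.1] -/
theorem exists_frames_hex_of_std' (hdV0 : ∀ i, dV i ≠ 0) (hdW0 : ∀ i, dW i ≠ 0)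
    {χ : HeckeCharacter L} {t : InfinitePlace L → ℤ} (ht : χ.HasUnitaryArchType t 0)
    (𝒦' : IwasawaDatum L e dV hdV dW hdW) (h𝒦' : 𝒦'.IsStd) (s₀ : ℂ) {m : ℕ}
    (A : Fin m → UnitaryGroup.arch (Fp L) L (IsCMField.complexConj L) (2 + 2) (hermD L e dV hdV dW hdW) → ℂ)
    (hAlaw : ∀ j, ∀ p : HA L e dV hdV dW hdW, IsSiegelDelta L e dV hdV dW hdW p → UnitaryGroup.finPart (Fp L) L (IsCMField.complexConj L) (2 + 2) (hermD L e dV hdV dW hdW) p = 1 →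
      ∀ x : UnitaryGroup.arch (Fp L) L (IsCMField.complexConj L) (2 + 2) (hermD L e dV hdV dW hdW),
        A j (UnitaryGroup.archPart (Fp L) L (IsCMField.complexConj L) (2 + 2) (hermD L e dV hdV dW hdW) p * x) = siegelDeltaCharacter L e dV hdV dW hdW χ s₀ p * A j x)
    (hfin : ∀ j, ∃ V : Submodule ℂ (UnitaryGroup.arch (Fp L) L (IsCMField.complexConj L) (2 + 2) (hermD L e dV hdV dW hdW) → ℂ), FiniteDimensional ℂ V ∧ A j ∈ V ∧
      ∀ a₀ : UnitaryGroup.arch (Fp L) L (IsCMField.complexConj L) (2 + 2) (hermD L e dV hdV dW hdW),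
        (UnitaryGroup.archToAdelic (Fp L) L (IsCMField.complexConj L) (2 + 2) (hermD L e dV hdV dW hdW) a₀ : HA L e dV hdV dW hdW) ∈ 𝒦'.K → ∀ G ∈ V, (fun x => G (x * a₀)) ∈ V)
    (hAc : ∀ j, Continuous (A j))
    (FinfT : Fin m → skewMatrices ((IsCMField.complexConj L : L ≃ₐ[Fp L] L) : L →+* L) ((gramR L e dV hdV dW hdW).map (algebraMap (Fp L) L)) →
      HA L e dV hdV dW hdW → ℂ → UnitaryGroup.arch (Fp L) L (IsCMField.complexConj L) (2 + 2) (hermD L e dV hdV dW hdW) → ℂ)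
    (hread : ∀ (S : skewMatrices ((IsCMField.complexConj L : L ≃ₐ[Fp L] L) : L →+* L) ((gramR L e dV hdV dW hdW).map (algebraMap (Fp L) L)))
      (h : HA L e dV hdV dW hdW) (s : ℂ) (j : Fin m) (a : UnitaryGroup.arch (Fp L) L (IsCMField.complexConj L) (2 + 2) (hermD L e dV hdV dW hdW)),
      FinfT j S h s a =
        (((modDelta L e dV hdV dW hdW (𝒦'.pPart (UnitaryGroup.archToAdelic (Fp L) L (IsCMField.complexConj L) (2 + 2) (hermD L e dV hdV dW hdW) a)) : ℝ) : ℂ) ^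
            (2 * (s - s₀))) * A j a)
    (T₀ : Finset (HeightOneSpectrum (𝓞 (Fp L))))
    (νinf : Finset (HeightOneSpectrum (𝓞 (Fp L))) → Measure ↥(unipDeltaArch L e dV hdV dW hdW)) [∀ T' : Finset (HeightOneSpectrum (𝓞 (Fp L))), (νinf T').IsHaarMeasure] :
    ∃ (T Tinv : {w : InfinitePlace L // w.IsComplex} → Matrix (Fin 2 ⊕ Fin 2) (Fin 2 ⊕ Fin 2) ℂ)
      (Fr : UnitaryGroup.arch (Fp L) L (IsCMField.complexConj L) (2 + 2) (hermD L e dV hdV dW hdW) →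
        {w : InfinitePlace L // w.IsComplex} → Matrix (Fin 2 ⊕ Fin 2) (Fin 2 ⊕ Fin 2) ℂ)
      (B C : {w : InfinitePlace L // w.IsComplex} → Matrix (Fin 2) (Fin 2) ℂ)
      (g : UnitaryGroup.arch (Fp L) L (IsCMField.complexConj L) (2 + 2) (hermD L e dV hdV dW hdW)),
      (∀ w, T w = fromBlocks (diagonal (fun k => (Real.sqrt (|(w.1.embedding (dV (e.symm k).1 * dW (e.symm k).2)).re| / 2) : ℂ))) (diagonal (fun k => (Real.sqrt (|(w.1.embedding (dV (e.symm k).1 * dW (e.symm k).2)).re| / 2) : ℂ)))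
          (diagonal (fun k => I * ((((w.1.embedding (dV (e.symm k).1 * dW (e.symm k).2)).re / |(w.1.embedding (dV (e.symm k).1 * dW (e.symm k).2)).re|) * Real.sqrt (|(w.1.embedding (dV (e.symm k).1 * dW (e.symm k).2)).re| / 2) : ℝ) : ℂ))) (-diagonal (fun k => I * ((((w.1.embedding (dV (e.symm k).1 * dW (e.symm k).2)).re / |(w.1.embedding (dV (e.symm k).1 * dW (e.symm k).2)).re|) * Real.sqrt (|(w.1.embedding (dV (e.symm k).1 * dW (e.symm k).2)).re| / 2) : ℝ) : ℂ)))) ∧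
      (∀ w, Tinv w = fromBlocks (diagonal (fun k => (((Real.sqrt (|(w.1.embedding (dV (e.symm k).1 * dW (e.symm k).2)).re| / 2))⁻¹ / 2 : ℝ) : ℂ))) (-diagonal (fun k => I * (((Real.sqrt (|(w.1.embedding (dV (e.symm k).1 * dW (e.symm k).2)).re| / 2))⁻¹ * ((w.1.embedding (dV (e.symm k).1 * dW (e.symm k).2)).re / |(w.1.embedding (dV (e.symm k).1 * dW (e.symm k).2)).re|) / 2 : ℝ) : ℂ)))
          (diagonal (fun k => (((Real.sqrt (|(w.1.embedding (dV (e.symm k).1 * dW (e.symm k).2)).re| / 2))⁻¹ / 2 : ℝ) : ℂ))) (diagonal (fun k => I * (((Real.sqrt (|(w.1.embedding (dV (e.symm k).1 * dW (e.symm k).2)).re| / 2))⁻¹ * ((w.1.embedding (dV (e.symm k).1 * dW (e.symm k).2)).re / |(w.1.embedding (dV (e.symm k).1 * dW (e.symm k).2)).re|) / 2 : ℝ) : ℂ)))) ∧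
      (∀ a w, Fr a w = T w * Matrix.reindex (e₂ (n := 2)).symm (e₂ (n := 2)).symm
        (((UnitaryGroup.archAt (Fp L) L (IsCMField.complexConj L) (2 + 2) (hermD L e dV hdV dW hdW) w
          (UnitaryGroup.complexConj_smul_infinitePlace L w.1) (IsCMField.complexConj_ne_one L) a :
            UnitaryGroup.archLocal L (2 + 2) (hermD L e dV hdV dW hdW) w) : GL (Fin (2 + 2)) ℂ) : Matrix (Fin (2 + 2)) (Fin (2 + 2)) ℂ) * Tinv w) ∧
      (∀ w, T w * Tinv w = 1) ∧ (∀ w, Tinv w * T w = 1) ∧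
      (∀ w (g : GL (Fin (2 + 2)) ℂ), g ∈ UnitaryGroup.archLocal L (2 + 2) (hermD L e dV hdV dW hdW) w →
        (T w * Matrix.reindex (e₂ (n := 2)).symm (e₂ (n := 2)).symm (g : Matrix _ _ ℂ) * Tinv w)ᴴ * Matrix.J (Fin 2) ℂ *
          (T w * Matrix.reindex (e₂ (n := 2)).symm (e₂ (n := 2)).symm (g : Matrix _ _ ℂ) * Tinv w) = Matrix.J (Fin 2) ℂ) ∧
      (∀ w (g : GL (Fin (2 + 2)) ℂ), IsSiegelM (n := 2) (g : Matrix (Fin (2 + 2)) (Fin (2 + 2)) ℂ) →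
        (T w * Matrix.reindex (e₂ (n := 2)).symm (e₂ (n := 2)).symm (g : Matrix _ _ ℂ) * Tinv w).toBlocks₂₁ = 0) ∧
      (∀ w (u : GL (Fin (2 + 2)) ℂ), u ∈ UnitaryGroup.archLocal L (2 + 2) (hermD L e dV hdV dW hdW) w →
        K2LiuSiegelUnipotentLocalDefs.IsUnipM (n := 2) (u : Matrix (Fin (2 + 2)) (Fin (2 + 2)) ℂ) →
          ∃ b : Matrix (Fin 2) (Fin 2) ℂ, bᴴ = b ∧ T w * Matrix.reindex (e₂ (n := 2)).symm (e₂ (n := 2)).symm (u : Matrix _ _ ℂ) * Tinv w = fromBlocks 1 b 0 1) ∧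
      (∀ w (b : Matrix (Fin 2) (Fin 2) ℂ), bᴴ = b → ∃ u : GL (Fin (2 + 2)) ℂ,
        u ∈ UnitaryGroup.archLocal L (2 + 2) (hermD L e dV hdV dW hdW) w ∧ K2LiuSiegelUnipotentLocalDefs.IsUnipM (n := 2) (u : Matrix (Fin (2 + 2)) (Fin (2 + 2)) ℂ) ∧
          T w * Matrix.reindex (e₂ (n := 2)).symm (e₂ (n := 2)).symm (u : Matrix _ _ ℂ) * Tinv w = fromBlocks 1 b 0 1) ∧
      (∀ w (P : Matrix (Fin 2 ⊕ Fin 2) (Fin 2 ⊕ Fin 2) ℂ), Pᴴ * Matrix.J (Fin 2) ℂ * P = Matrix.J (Fin 2) ℂ →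
        ∃ g : GL (Fin (2 + 2)) ℂ, g ∈ UnitaryGroup.archLocal L (2 + 2) (hermD L e dV hdV dW hdW) w ∧
          T w * Matrix.reindex (e₂ (n := 2)).symm (e₂ (n := 2)).symm (g : Matrix _ _ ℂ) * Tinv w = P) ∧
      (∀ w, T w * fromBlocks 1 0 0 (-1) * Tinv w = fromBlocks 0 (B w) (C w) 0) ∧ (∀ w, IsUnit (C w).det) ∧
      (∀ k : UnitaryGroup.arch (Fp L) L (IsCMField.complexConj L) (2 + 2) (hermD L e dV hdV dW hdW),
        (∀ w, moeb (Fr k w) (I • (1 : Matrix (Fin 2) (Fin 2) ℂ)) = I • 1) →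
          (UnitaryGroup.archToAdelic (Fp L) L (IsCMField.complexConj L) (2 + 2) (hermD L e dV hdV dW hdW) (g * k * g⁻¹) : HA L e dV hdV dW hdW) ∈ 𝒦'.K) ∧
      ∀ eb : skewMatrices ((IsCMField.complexConj L : L ≃ₐ[Fp L] L) : L →+* L) ((gramR L e dV hdV dW hdW).map (algebraMap (Fp L) L)) → HA L e dV hdV dW hdW →
      {w : InfinitePlace L // w.IsComplex} → Matrix (Fin 2) (Fin 2) ℂ → ℂ,
        (∀ (S : skewMatrices ((IsCMField.complexConj L : L ≃ₐ[Fp L] L) : L →+* L) ((gramR L e dV hdV dW hdW).map (algebraMap (Fp L) L)))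
      (h : HA L e dV hdV dW hdW) (u : ↥(unipDeltaArch L e dV hdV dW hdW)),
      (conj (unipDeltaChar L e dV hdV dW hdW (S : Matrix (Fin 2) (Fin 2) L)
          (UnitaryGroup.archToAdelic (Fp L) L (IsCMField.complexConj L) (2 + 2) (hermD L e dV hdV dW hdW)
            (u : UnitaryGroup.arch (Fp L) L (IsCMField.complexConj L) (2 + 2) (hermD L e dV hdV dW hdW))) : ℂ)) =
        ∏ w, eb S h w (Matrix.toBlocks₁₂ (Fr (u : UnitaryGroup.arch (Fp L) L (IsCMField.complexConj L) (2 + 2) (hermD L e dV hdV dW hdW)) w))) →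
        (∀ (S : skewMatrices ((IsCMField.complexConj L : L ≃ₐ[Fp L] L) : L →+* L) ((gramR L e dV hdV dW hdW).map (algebraMap (Fp L) L))),
      (S : Matrix (Fin 2) (Fin 2) L).det ≠ 0 → ∀ (h : HA L e dV hdV dW hdW) (w : {w : InfinitePlace L // w.IsComplex}) (Q : Carrier),
      ∃ Ew : ℂ → ℂ, DifferentiableOn ℂ Ew {s : ℂ | 0 < s.re} ∧ ∀ s : ℂ, ((2 : ℕ) : ℝ) / 2 < s.re →
        ∀ F : Matrix (Fin 2 ⊕ Fin 2) (Fin 2 ⊕ Fin 2) ℂ → ℂ, IsArchSiegelSection (fun z : ℂ => (conj z / ((‖z‖ : ℝ) : ℂ)) ^ (-(t w.1))) s F →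
          (∀ (v : Matrix (Fin 2) (Fin 2) ℂ), vᴴ * v = 1 → ∀ hv : v.det ≠ 0,
            F ((2 : ℂ)⁻¹ • fromBlocks (1 + v) (-(I • (1 - v))) (I • (1 - v)) (1 + v) : Matrix (Fin 2 ⊕ Fin 2) (Fin 2 ⊕ Fin 2) ℂ) = evalAt v hv Q) →
          ∫ x : Fin 2 → Fin 2 → ℝ, F ((fromBlocks 0 (B w) (C w) 0 : Matrix (Fin 2 ⊕ Fin 2) (Fin 2 ⊕ Fin 2) ℂ) * fromBlocks 1 (hermOfReal x) 0 1 *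
              Fr (UnitaryGroup.archPart (Fp L) L (IsCMField.complexConj L) (2 + 2) (hermD L e dV hdV dW hdW) h * g) w) *
            eb S h w (hermOfReal x) = Ew s) →
      ∀ (j : Fin m) (S : skewMatrices ((IsCMField.complexConj L : L ≃ₐ[Fp L] L) : L →+* L) ((gramR L e dV hdV dW hdW).map (algebraMap (Fp L) L)))
        (h : HA L e dV hdV dW hdW), (S : Matrix (Fin 2) (Fin 2) L).det ≠ 0 →
        ∃ F : ℂ → ℂ, DifferentiableOn ℂ F {s : ℂ | 0 < s.re} ∧ ∀ s : ℂ, ((2 : ℕ) : ℝ) / 2 < s.re → F s =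
          archWhittakerIntegral L e dV hdV dW hdW (νinf (kindWFinset L e dV hdV dW hdW T₀ (S : Matrix (Fin 2) (Fin 2) L) h)) (S : Matrix (Fin 2) (Fin 2) L)
            (FinfT j S h) (UnitaryGroup.archPart (Fp L) L (IsCMField.complexConj L) (2 + 2) (hermD L e dV hdV dW hdW) h) s := by
  -- ★ p863520 §3's preamble, verbatim: the tube frames of record (★ arch₄) `choose`n once, their anti-diagonal reading, the Shimura invertibility
  choose T Tinv h1 h2 hTU hTS hTiv hTN hTV hW hTdef hTinvdef using fun w : {w : InfinitePlace L // w.IsComplex} =>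
    exists_tubeFrame_arch₄ L e dV hdV dW hdW w (UnitaryGroup.complexConj_smul_infinitePlace L w.1) hdV0 hdW0
  choose B C hCu hBC using hW
  have hDC := fun w : {w : InfinitePlace L // w.IsComplex} => isUnit_det_shimuraFrame (n := 2)
    (fun k => (w.1.embedding (dV (e.symm k).1 * dW (e.symm k).2)).re)
    (tw_ne_zero L e dV hdV dW hdW w (UnitaryGroup.complexConj_smul_infinitePlace L w.1) hdV0 hdW0)
  obtain ⟨Fr, hFr⟩ : ∃ Fr : UnitaryGroup.arch (Fp L) L (IsCMField.complexConj L) (2 + 2) (hermD L e dV hdV dW hdW) → {w : InfinitePlace L // w.IsComplex} → Matrix (Fin 2 ⊕ Fin 2) (Fin 2 ⊕ Fin 2) ℂ,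
      ∀ k w, Fr k w = T w * Matrix.reindex (e₂ (n := 2)).symm (e₂ (n := 2)).symm (((UnitaryGroup.archAt (Fp L) L (IsCMField.complexConj L) (2 + 2) (hermD L e dV hdV dW hdW) w (UnitaryGroup.complexConj_smul_infinitePlace L w.1) (IsCMField.complexConj_ne_one L) k : UnitaryGroup.archLocal L (2 + 2) (hermD L e dV hdV dW hdW) w) : GL (Fin (2 + 2)) ℂ) : Matrix (Fin (2 + 2)) (Fin (2 + 2)) ℂ) * Tinv w :=
    ⟨_, fun _ _ => rfl⟩
  -- reading frames
  obtain ⟨fr, hfrM, hfrc, -⟩ := exists_readingFrame L e dV hdV dW hdW hdV0 hdW0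
  have hfrτ : ∀ w (u : Matrix.unitaryGroup (Fin 2) ℂ),
      T w * Matrix.reindex (e₂ (n := 2)).symm (e₂ (n := 2)).symm (((fr w u : UnitaryGroup.archLocal L (2 + 2) (hermD L e dV hdV dW hdW) w) : GL (Fin (2 + 2)) ℂ) :
        Matrix (Fin (2 + 2)) (Fin (2 + 2)) ℂ) * Tinv w =
      (2 : ℂ)⁻¹ • fromBlocks (1 + (u : Matrix (Fin 2) (Fin 2) ℂ)) (-(I • (1 - (u : Matrix (Fin 2) (Fin 2) ℂ)))) (I • (1 - (u : Matrix (Fin 2) (Fin 2) ℂ))) (1 + (u : Matrix (Fin 2) (Fin 2) ℂ)) := by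
    intro w u
    have hG := hfrM w u
    rw [← hTdef w, ← hTinvdef w] at hG
    rw [tube_eq_of_chart_formula (T w) (Tinv w) (h1 w) hG, kappa_eq]
  -- the conjugator of ★ FILE 21 for the standard datum, read in the frame
  obtain ⟨g, hg⟩ := exists_frameCompact_conjugator L e dV hdV hdV0 dW hdW hdW0 h𝒦' T Tinv hTdef hTinvdef
  have hg' : ∀ k : UnitaryGroup.arch (Fp L) L (IsCMField.complexConj L) (2 + 2) (hermD L e dV hdV dW hdW), (∀ w, moeb (Fr k w) (I • (1 : Matrix (Fin 2) (Fin 2) ℂ)) = I • 1) →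
      (UnitaryGroup.archToAdelic (Fp L) L (IsCMField.complexConj L) (2 + 2) (hermD L e dV hdV dW hdW) (g * k * g⁻¹) : HA L e dV hdV dW hdW) ∈ 𝒦'.K :=
    fun k hk => hg k fun w => by rw [← hFr]; exact hk w
  refine ⟨T, Tinv, Fr, B, C, g, hTdef, hTinvdef, hFr, h1, h2, hTU, hTS, hTiv, hTN, hTV, hBC, hCu, hg', fun eb heb hWl => ?_⟩
  exact hex_of_conjugator' L e dV hdV dW hdW Fr T Tinv hFr h2 hTU hdV0 hdW0 h1 hTiv hTN hTS hTV
    (fun w => diagonal fun k => (Real.sqrt (|(w.1.embedding (dV (e.symm k).1 * dW (e.symm k).2)).re| / 2) : ℂ))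
    (fun w => diagonal fun k => I * ((((w.1.embedding (dV (e.symm k).1 * dW (e.symm k).2)).re / |(w.1.embedding (dV (e.symm k).1 * dW (e.symm k).2)).re|) *
      Real.sqrt (|(w.1.embedding (dV (e.symm k).1 * dW (e.symm k).2)).re| / 2) : ℝ) : ℂ))
    hTdef (fun w => (hDC w).1) (fun w => (hDC w).2) fr hfrc hfrτ B C hBC T₀ νinf 𝒦' g hg' ht s₀ A hAlaw hfin hAc FinfT hread eb heb hWl

end Summit.HodgeConjecture.HodgeConjecture.Cruxes.HLiu418.K2LiuKindWArchContinuationGuardedOfRecord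

end
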